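import Summits.QuantumFields.YangMills.Theorems.BalabanUVNodesN21GappedTopPair13CoPHSlotDefs
import Summits.QuantumFields.YangMills.Theorems.BalabanUVNodesN21GappedTopReading13CoPHDefs

/-!
# N21 (NE7c) · THE DOUBLY-GAPPED SPINE READING `crGap2₁₃VAt K₀ jcut ρ ρ′ n₁ n₂ : SpineReading₁₃CoPH N` — definition lane: the lane owner's gapped reading `crGap₁₃VAt`
# field for field, EXCEPT that BOTH indicator families of the last 𝐓-step are re-lettered — the (3.2) depth `i⋆` is selected by the two-run badness of the a-MAJORANTS
# along the grid `ε(1−ρ)^i`, the (3.3) depth `j⋆` INDEPENDENTLY by that of the b-MAJORANTS along `2δ(1−ρ′)^j`, and the shell parts are the fibre sums of the TWO-COLLAR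
# shells `topGap2ShellAt(θ_{i⋆+2},θ_{i⋆+1},θ_{i⋆}; δ′_{j⋆+2},δ′_{j⋆+1},δ′_{j⋆})` (companion `…GappedTopPairReading13CoPH`)

WIDTH SEAT `pub-ymgap-dag-n21-w7` (g2), node N21 = NE7c; lane K3⁸ `SpineGivenEndpointR13SepCoPHV` (stmt-QuantumFields-27366, `--supports … --as helper`; COUNT-NEUTRAL).
DEFINITION LANE; NO estimate.  Imports this seat's `…GappedTopPair13CoPHSlotDefs` (`topClassWeight2At`, `topGap2ShellAt∕CoreAt`, `collarBAt`, `bCutGrid`) and the lane owner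
dag-n21-d's U5 `…GappedTopReading13CoPHDefs` (p620791: the `crGap₁₃VAt` vocabulary; through it R1 `topTermAtLevel`, the letter types `WidthLetter₁₃CoPH ∕ DepthLetter₁₃CoPH`,
n20-d's `crOfRecord₁₃V` vocabulary `classSet₁₃ ∕ keyA₁₃ ∕ keyB₁₃ ∕ badClass₁₃ ∕ runA₁₃ ∕ runB₁₃ ∕ histA₁₃ ∕ histB₁₃`, the canonical weights `wInf ∕ wshInf ∕ deltaCan`).
The READING twin of CLAIM-4, assigned to this seat by the lane owner (dag-n21-d g12, cell bus 2026-08-28 11:14Z: «pair READING twins: GO — YOURS; V1 instantiates at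
`crGap2₁₃V` the hour reading + faces land»).

WHAT IS DEFINED (all at a `CoPH`-keyed Stage-13 tuple `(F, θ, hP, g₀, os)`, offset `K₀`, comparison `K`, source `t`; dials: widths `ρ, ρ′ : ℕ → ℝ`, depth budgets
`n₁, n₂ : ℕ → ℕ`).
* §D1 level-polymorphic objects at NODE 00's generality: `topTerm2AtLevel` (pair-lettered term), `topGap2ShellAtLevel`, `topGap2CoreAtLevel` (+ `term − shell = core`),
  `majorantA2AtLevel θlo θhi t j := ∫ collarA(θlo,θhi)(Ū)·Σ_s h_s` and `majorantB2AtLevel δlo δhi t j := ∫ Σ_s collarB(δlo,δhi)(s)(U,Ū)·h_s` at level `j = k + 1` (`0` at level `0`).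
* §D2 the two runs' MAJORANT masses along their grids `majA2SumA₁₃ ∕ majA2SumB₁₃` (depth `i`: collar `(θ_{i+2}, θ_i)`), `majB2SumA₁₃ ∕ majB2SumB₁₃` (depth `j`: collar
  `(δ′_{j+2}, δ′_j)`); the two badnesses `aBadness2₁₃ ∕ bBadness2₁₃` (normalised by the runs' partition functions); ★ the two SEPARATELY selected depths `selDepthA2₁₃` (argmin
  over `i ≤ n₁`) and `selDepthB2₁₃` (argmin over `j ≤ n₂`) (+ `_spec`, `_le`); the two runs' two-collar shell masses `gap2ShellSumA₁₃ ∕ gap2ShellSumB₁₃` at a depth pair.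
* §D3 keyed carriers at the selected middle letters `(θ_{i⋆+1}, δ′_{j⋆+1})`: `gapWeight2A₁₃ ∕ gapWeight2B₁₃` (fibre sums of the pair-lettered terms), `gapShell2A₁₃ ∕ gapShell2B₁₃`
  (two-collar shells), `gapCore2A₁₃ ∕ gapCore2B₁₃` (doubly-gapped cores; `gapWeight2 − gapShell2 = gapCore2` key by key).
* §D4 ★★ `crGap2₁₃VAt N K₀ jcut ρ ρ′ n₁ n₂ : SpineReading₁₃CoPH N` and `crGap2₁₃V := crGap2₁₃VAt N 0` — `crGap₁₃VAt` field for field with the doubly-gapped carriers; `rfl` dictionary.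

HONEST FRAMING (binding).  Definitions; NO estimate; the reading is NOT the K3 skeleton's `PinnedAtLive` pin (LOCATED: plan's decision ∕ the lane owner's reading-generic V1
knit); the residual `ζ` ∕ (3.5), the ℝ-side and everything below the top step are NOT re-lettered; the common-refinement comparison is the consumer's (n21-w2's junction
files); no `Provisos₁₃CoPH` inhabitant claimed (K0⁷ open); NE7c NOT PRINTED ∕ NOT proved at print's thresholds; N21 NOT discharged; K3⁸ NOT claimed; counts UNMOVED (typed
28∕28 · discharged 5∕27); never a count claim.  No `sorry`, no `axiom`, no `instance`, no `notation`.  One finite four-torus programme at fixed `ε` — NOT ℝ⁴, NOT OS, NOT a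
mass gap, NOT the Clay problem.
-/

noncomputable section

open scoped BigOperators
open Finset MeasureTheory

namespace Summit.QuantumFields.YangMills.Theorems.N21GappedTopPair13CoPH

open Literature.MathematicalPhysics.QuantumFieldTheory.Balaban1983to89
open Literature.MathematicalPhysics.QuantumFieldTheory.Balaban1983to89.T4Continuum
open Literature.MathematicalPhysics.QuantumFieldTheory.Balaban1983to89.Node00
open YMDAG.UVSplit (SpineReading₁₃CoPH keyA₁₃ keyB₁₃ runA₁₃ runB₁₃ histA₁₃ histB₁₃ classSet₁₃ badClass₁₃)
open Summit.QuantumFields.BalabanUV.T4Continuum.Spine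
open Summit.QuantumFields.YangMills.BalabanUVNodes.SpineCanonicalWeights
open Summit.QuantumFields.YangMills.Theorems.N21ShellSplitOfRecord13CoPH

/-! ## §D1 Level-polymorphic objects: the pair-lettered term, the two-collar shell, the doubly-gapped core, the two majorants -/

section Level2

variable (F : T4Family) (N : ℕ) [NeZero N] (ϑ : Stage9Params F N) (D : FiniteEpsData F (SU N)) (g₀ : ℕ → ℝ) (os : List (ULoop F))
  (p : B12.RunParams) (g : ℕ → ℝ)

/-- **THE PAIR-LETTERED TERM OF A HISTORY AT ITS OWN LEVEL**: the record's class weight at level `0` (no step), `topClassWeight2At … k θ δ′ t` at level `k + 1`. [bookkeeping] -/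
def topTerm2AtLevel (θ δ' t : ℝ) : (j : ℕ) → SeqOfRecord F ϑ.ν ϑ.τ9.M g p.K j → ℝ
  | 0 => fun s => classWeightOfDatum₉ F N ϑ D g₀ os p g 0 t s
  | k + 1 => fun s' => topClassWeight2At F N ϑ D g₀ os p g k θ δ' t s'

/-- **THE TWO-COLLAR SHELL OF A HISTORY AT ITS OWN LEVEL**: `0` at level `0`, `topGap2ShellAt … k` at level `k + 1`. [bookkeeping] -/
def topGap2ShellAtLevel (θlo θ θhi δlo δ' δhi t : ℝ) : (j : ℕ) → SeqOfRecord F ϑ.ν ϑ.τ9.M g p.K j → ℝ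
  | 0 => fun _ => 0
  | k + 1 => fun s' => topGap2ShellAt F N ϑ D g₀ os p g k θlo θ θhi δlo δ' δhi t s'

/-- **THE DOUBLY-GAPPED CORE OF A HISTORY AT ITS OWN LEVEL**: the record's class weight at level `0`, `topGap2CoreAt … k` at level `k + 1` — the definite object a consumer
matching the two runs' CORES reads on this road (NO top statistic of either family in either open collar). [bookkeeping] -/
def topGap2CoreAtLevel (θlo θhi δlo δhi t : ℝ) : (j : ℕ) → SeqOfRecord F ϑ.ν ϑ.τ9.M g p.K j → ℝ
  | 0 => fun s => classWeightOfDatum₉ F N ϑ D g₀ os p g 0 t s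
  | k + 1 => fun s' => topGap2CoreAt F N ϑ D g₀ os p g k θlo θhi δlo δhi t s'

/-- **THE a-MAJORANT AT A LEVEL** (collar `(θlo, θhi)`, source `t`): `0` at level `0`, `∫ collarA(θlo,θhi)(Ū)·Σ_s χ_k(s)slot_k(s)(U) dU` at level `k + 1` — free of the (3.3) letters.
[bookkeeping] -/
def majorantA2AtLevel (θlo θhi t : ℝ) : ℕ → ℝ
  | 0 => 0
  | k + 1 => ∫ U, collarAt F N ϑ.ν p g k θlo θhi ((avOfRecord F N p.K k).avg U) *
      ∑ s, chiSeqOfRecord F N ϑ.ν ϑ.τ9.M g p.K k s U * dressedSlotsOfDatum₉ F N ϑ D g₀ os t p g k s U ∂fieldMeasure (F.P p.K) k (SU N)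

/-- **THE b-MAJORANT AT A LEVEL** (collar `(δlo, δhi)`, source `t`): `0` at level `0`, `∫ Σ_s collarB(δlo,δhi)(s)(U,Ū)·χ_k(s)slot_k(s)(U) dU` at level `k + 1` — free of the (3.2)
letters. [bookkeeping] -/
def majorantB2AtLevel (δlo δhi t : ℝ) : ℕ → ℝ
  | 0 => 0
  | k + 1 => ∫ U, ∑ s, collarBAt F N ϑ.ν ϑ.τ9.M p g k δlo δhi s U ((avOfRecord F N p.K k).avg U) *
      (chiSeqOfRecord F N ϑ.ν ϑ.τ9.M g p.K k s U * dressedSlotsOfDatum₉ F N ϑ D g₀ os t p g k s U) ∂fieldMeasure (F.P p.K) k (SU N)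

/-- Face at level `0`. [bookkeeping] -/
@[simp] theorem topTerm2AtLevel_zero (θ δ' t : ℝ) (s : SeqOfRecord F ϑ.ν ϑ.τ9.M g p.K 0) :
    topTerm2AtLevel F N ϑ D g₀ os p g θ δ' t 0 s = classWeightOfDatum₉ F N ϑ D g₀ os p g 0 t s := rfl
/-- Face at a successor level. [bookkeeping] -/
@[simp] theorem topTerm2AtLevel_succ (θ δ' t : ℝ) (k : ℕ) (s' : SeqOfRecord F ϑ.ν ϑ.τ9.M g p.K (k + 1)) :
    topTerm2AtLevel F N ϑ D g₀ os p g θ δ' t (k + 1) s' = topClassWeight2At F N ϑ D g₀ os p g k θ δ' t s' := rfl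
/-- Face at level `0`. [bookkeeping] -/
@[simp] theorem topGap2ShellAtLevel_zero (θlo θ θhi δlo δ' δhi t : ℝ) (s : SeqOfRecord F ϑ.ν ϑ.τ9.M g p.K 0) :
    topGap2ShellAtLevel F N ϑ D g₀ os p g θlo θ θhi δlo δ' δhi t 0 s = 0 := rfl
/-- Face at a successor level. [bookkeeping] -/
@[simp] theorem topGap2ShellAtLevel_succ (θlo θ θhi δlo δ' δhi t : ℝ) (k : ℕ) (s' : SeqOfRecord F ϑ.ν ϑ.τ9.M g p.K (k + 1)) :
    topGap2ShellAtLevel F N ϑ D g₀ os p g θlo θ θhi δlo δ' δhi t (k + 1) s' = topGap2ShellAt F N ϑ D g₀ os p g k θlo θ θhi δlo δ' δhi t s' := rfl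
/-- Face at level `0`. [bookkeeping] -/
@[simp] theorem topGap2CoreAtLevel_zero (θlo θhi δlo δhi t : ℝ) (s : SeqOfRecord F ϑ.ν ϑ.τ9.M g p.K 0) :
    topGap2CoreAtLevel F N ϑ D g₀ os p g θlo θhi δlo δhi t 0 s = classWeightOfDatum₉ F N ϑ D g₀ os p g 0 t s := rfl
/-- Face at a successor level. [bookkeeping] -/
@[simp] theorem topGap2CoreAtLevel_succ (θlo θhi δlo δhi t : ℝ) (k : ℕ) (s' : SeqOfRecord F ϑ.ν ϑ.τ9.M g p.K (k + 1)) :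
    topGap2CoreAtLevel F N ϑ D g₀ os p g θlo θhi δlo δhi t (k + 1) s' = topGap2CoreAt F N ϑ D g₀ os p g k θlo θhi δlo δhi t s' := rfl
/-- Face at level `0`. [bookkeeping] -/
@[simp] theorem majorantA2AtLevel_zero (θlo θhi t : ℝ) : majorantA2AtLevel F N ϑ D g₀ os p g θlo θhi t 0 = 0 := rfl
/-- Face at level `0`. [bookkeeping] -/
@[simp] theorem majorantB2AtLevel_zero (δlo δhi t : ℝ) : majorantB2AtLevel F N ϑ D g₀ os p g δlo δhi t 0 = 0 := rfl
/-- Face at a successor level. [bookkeeping] -/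
theorem majorantA2AtLevel_succ (θlo θhi t : ℝ) (k : ℕ) : majorantA2AtLevel F N ϑ D g₀ os p g θlo θhi t (k + 1) =
    ∫ U, collarAt F N ϑ.ν p g k θlo θhi ((avOfRecord F N p.K k).avg U) *
      ∑ s, chiSeqOfRecord F N ϑ.ν ϑ.τ9.M g p.K k s U * dressedSlotsOfDatum₉ F N ϑ D g₀ os t p g k s U ∂fieldMeasure (F.P p.K) k (SU N) := rfl
/-- Face at a successor level. [bookkeeping] -/
theorem majorantB2AtLevel_succ (δlo δhi t : ℝ) (k : ℕ) : majorantB2AtLevel F N ϑ D g₀ os p g δlo δhi t (k + 1) =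
    ∫ U, ∑ s, collarBAt F N ϑ.ν ϑ.τ9.M p g k δlo δhi s U ((avOfRecord F N p.K k).avg U) *
      (chiSeqOfRecord F N ϑ.ν ϑ.τ9.M g p.K k s U * dressedSlotsOfDatum₉ F N ϑ D g₀ os t p g k s U) ∂fieldMeasure (F.P p.K) k (SU N) := rfl

/-- **TERM − TWO-COLLAR SHELL = DOUBLY-GAPPED CORE at every level** (level `0`: `term − 0`; level `k + 1`: `topGap2ShellAt := topClassWeight2At − topGap2CoreAt`). [bookkeeping] -/
theorem topTerm2AtLevel_sub_topGap2ShellAtLevel (θlo θ θhi δlo δ' δhi t : ℝ) :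
    ∀ (j : ℕ) (s : SeqOfRecord F ϑ.ν ϑ.τ9.M g p.K j),
      topTerm2AtLevel F N ϑ D g₀ os p g θ δ' t j s - topGap2ShellAtLevel F N ϑ D g₀ os p g θlo θ θhi δlo δ' δhi t j s =
        topGap2CoreAtLevel F N ϑ D g₀ os p g θlo θhi δlo δhi t j s
  | 0, s => by simp
  | k + 1, s' => by simp [topGap2ShellAt]

end Level2

/-! ## §D2 At the `CoPH`-keyed Stage-13 record: majorant masses along the two grids, the two badnesses, the two SEPARATELY selected depths -/

section Reading2

variable {F : T4Family} {N : ℕ} [NeZero N]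

/-- **RUN A's a-MAJORANT MASS AT DEPTH `i`** (comparison `K`, top `K₀ + K`, width `ρ K`, source `t`; collar `(θ_{i+2}, θ_i)`). [bookkeeping] -/
def majA2SumA₁₃ (θ : Stage13HParams F N) (hP : θ.Provisos₁₃CoPH F N) (K₀ : ℕ) (g₀ : ℕ → ℝ) (os : List (ULoop F)) (ρ : ℕ → ℝ) (K i : ℕ) (t : ℝ) : ℝ :=
  majorantA2AtLevel F N θ.toStage9Params (datumOfRecord₁₃CoPH F N θ hP) g₀ os (runA₁₃ F K₀ g₀ K) (histA₁₃ θ K₀ g₀ K)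
    (cutGrid θ.ν (histA₁₃ θ K₀ g₀ K) (K₀ + K) (ρ K) (i + 2)) (cutGrid θ.ν (histA₁₃ θ K₀ g₀ K) (K₀ + K) (ρ K) i) t (K₀ + K)

/-- **RUN B's a-MAJORANT MASS AT DEPTH `i`** (top `K₀ + K + 1`). [bookkeeping] -/
def majA2SumB₁₃ (θ : Stage13HParams F N) (hP : θ.Provisos₁₃CoPH F N) (K₀ : ℕ) (g₀ : ℕ → ℝ) (os : List (ULoop F)) (ρ : ℕ → ℝ) (K i : ℕ) (t : ℝ) : ℝ :=
  majorantA2AtLevel F N θ.toStage9Params (datumOfRecord₁₃CoPH F N θ hP) g₀ os (runB₁₃ F K₀ g₀ K) (histB₁₃ θ K₀ g₀ K)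
    (cutGrid θ.ν (histB₁₃ θ K₀ g₀ K) (K₀ + K + 1) (ρ K) (i + 2)) (cutGrid θ.ν (histB₁₃ θ K₀ g₀ K) (K₀ + K + 1) (ρ K) i) t (K₀ + K + 1)

/-- **RUN A's b-MAJORANT MASS AT DEPTH `j`** (width `ρ′ K`; collar `(δ′_{j+2}, δ′_j)` on the (3.3) grid of the old level `K₀ + K − 1`). [bookkeeping] -/
def majB2SumA₁₃ (θ : Stage13HParams F N) (hP : θ.Provisos₁₃CoPH F N) (K₀ : ℕ) (g₀ : ℕ → ℝ) (os : List (ULoop F)) (ρ' : ℕ → ℝ) (K j : ℕ) (t : ℝ) : ℝ :=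
  majorantB2AtLevel F N θ.toStage9Params (datumOfRecord₁₃CoPH F N θ hP) g₀ os (runA₁₃ F K₀ g₀ K) (histA₁₃ θ K₀ g₀ K)
    (bCutGrid θ.ν θ.A₁ (histA₁₃ θ K₀ g₀ K) (K₀ + K - 1) (ρ' K) (j + 2)) (bCutGrid θ.ν θ.A₁ (histA₁₃ θ K₀ g₀ K) (K₀ + K - 1) (ρ' K) j) t (K₀ + K)

/-- **RUN B's b-MAJORANT MASS AT DEPTH `j`** (old level `K₀ + K`). [bookkeeping] -/
def majB2SumB₁₃ (θ : Stage13HParams F N) (hP : θ.Provisos₁₃CoPH F N) (K₀ : ℕ) (g₀ : ℕ → ℝ) (os : List (ULoop F)) (ρ' : ℕ → ℝ) (K j : ℕ) (t : ℝ) : ℝ :=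
  majorantB2AtLevel F N θ.toStage9Params (datumOfRecord₁₃CoPH F N θ hP) g₀ os (runB₁₃ F K₀ g₀ K) (histB₁₃ θ K₀ g₀ K)
    (bCutGrid θ.ν θ.A₁ (histB₁₃ θ K₀ g₀ K) (K₀ + K) (ρ' K) (j + 2)) (bCutGrid θ.ν θ.A₁ (histB₁₃ θ K₀ g₀ K) (K₀ + K) (ρ' K) j) t (K₀ + K + 1)

/-- **THE TWO-RUN BADNESS OF AN a-DEPTH**: the two runs' a-majorant masses at depth `i`, each normalised by its run's dressed partition function (`x ∕ 0 = 0`). [bookkeeping] -/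
def aBadness2₁₃ (θ : Stage13HParams F N) (hP : θ.Provisos₁₃CoPH F N) (K₀ : ℕ) (g₀ : ℕ → ℝ) (os : List (ULoop F)) (ρ : ℕ → ℝ) (K : ℕ) (t : ℝ) (i : ℕ) : ℝ :=
  majA2SumA₁₃ θ hP K₀ g₀ os ρ K i t / T4GenFunBounds.schemeZ ((datumOfRecord₁₃CoPH F N θ hP).scheme g₀) os (K₀ + K) t +
    majA2SumB₁₃ θ hP K₀ g₀ os ρ K i t / T4GenFunBounds.schemeZ ((datumOfRecord₁₃CoPH F N θ hP).scheme g₀) os (K₀ + K + 1) t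

/-- **THE TWO-RUN BADNESS OF A b-DEPTH.** [bookkeeping] -/
def bBadness2₁₃ (θ : Stage13HParams F N) (hP : θ.Provisos₁₃CoPH F N) (K₀ : ℕ) (g₀ : ℕ → ℝ) (os : List (ULoop F)) (ρ' : ℕ → ℝ) (K : ℕ) (t : ℝ) (j : ℕ) : ℝ :=
  majB2SumA₁₃ θ hP K₀ g₀ os ρ' K j t / T4GenFunBounds.schemeZ ((datumOfRecord₁₃CoPH F N θ hP).scheme g₀) os (K₀ + K) t +
    majB2SumB₁₃ θ hP K₀ g₀ os ρ' K j t / T4GenFunBounds.schemeZ ((datumOfRecord₁₃CoPH F N θ hP).scheme g₀) os (K₀ + K + 1) t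

/-- ★ **THE SELECTED a-DEPTH** `i⋆(K, t) ≤ n₁`: an argmin of the a-badness over `0, …, n₁`. [bookkeeping] -/
def selDepthA2₁₃ (θ : Stage13HParams F N) (hP : θ.Provisos₁₃CoPH F N) (K₀ : ℕ) (g₀ : ℕ → ℝ) (os : List (ULoop F)) (ρ : ℕ → ℝ) (n₁ K : ℕ) (t : ℝ) : ℕ :=
  Classical.choose ((Finset.range (n₁ + 1)).exists_min_image (aBadness2₁₃ θ hP K₀ g₀ os ρ K t) ⟨0, Finset.mem_range.2 (Nat.succ_pos n₁)⟩)

/-- ★ **THE SELECTED b-DEPTH** `j⋆(K, t) ≤ n₂`: an argmin of the b-badness over `0, …, n₂` — selected INDEPENDENTLY of `i⋆` (the majorants separate). [bookkeeping] -/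
def selDepthB2₁₃ (θ : Stage13HParams F N) (hP : θ.Provisos₁₃CoPH F N) (K₀ : ℕ) (g₀ : ℕ → ℝ) (os : List (ULoop F)) (ρ' : ℕ → ℝ) (n₂ K : ℕ) (t : ℝ) : ℕ :=
  Classical.choose ((Finset.range (n₂ + 1)).exists_min_image (bBadness2₁₃ θ hP K₀ g₀ os ρ' K t) ⟨0, Finset.mem_range.2 (Nat.succ_pos n₂)⟩)

/-- Spec of the selected a-depth. [bookkeeping] -/
theorem selDepthA2₁₃_spec (θ : Stage13HParams F N) (hP : θ.Provisos₁₃CoPH F N) (K₀ : ℕ) (g₀ : ℕ → ℝ) (os : List (ULoop F)) (ρ : ℕ → ℝ) (n₁ K : ℕ) (t : ℝ) :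
    selDepthA2₁₃ θ hP K₀ g₀ os ρ n₁ K t ∈ Finset.range (n₁ + 1) ∧
      ∀ i ∈ Finset.range (n₁ + 1), aBadness2₁₃ θ hP K₀ g₀ os ρ K t (selDepthA2₁₃ θ hP K₀ g₀ os ρ n₁ K t) ≤ aBadness2₁₃ θ hP K₀ g₀ os ρ K t i :=
  Classical.choose_spec ((Finset.range (n₁ + 1)).exists_min_image (aBadness2₁₃ θ hP K₀ g₀ os ρ K t) ⟨0, Finset.mem_range.2 (Nat.succ_pos n₁)⟩)

/-- Spec of the selected b-depth. [bookkeeping] -/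
theorem selDepthB2₁₃_spec (θ : Stage13HParams F N) (hP : θ.Provisos₁₃CoPH F N) (K₀ : ℕ) (g₀ : ℕ → ℝ) (os : List (ULoop F)) (ρ' : ℕ → ℝ) (n₂ K : ℕ) (t : ℝ) :
    selDepthB2₁₃ θ hP K₀ g₀ os ρ' n₂ K t ∈ Finset.range (n₂ + 1) ∧
      ∀ j ∈ Finset.range (n₂ + 1), bBadness2₁₃ θ hP K₀ g₀ os ρ' K t (selDepthB2₁₃ θ hP K₀ g₀ os ρ' n₂ K t) ≤ bBadness2₁₃ θ hP K₀ g₀ os ρ' K t j :=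
  Classical.choose_spec ((Finset.range (n₂ + 1)).exists_min_image (bBadness2₁₃ θ hP K₀ g₀ os ρ' K t) ⟨0, Finset.mem_range.2 (Nat.succ_pos n₂)⟩)

/-- The selected a-depth is at most `n₁`. [bookkeeping] -/
theorem selDepthA2₁₃_le (θ : Stage13HParams F N) (hP : θ.Provisos₁₃CoPH F N) (K₀ : ℕ) (g₀ : ℕ → ℝ) (os : List (ULoop F)) (ρ : ℕ → ℝ) (n₁ K : ℕ) (t : ℝ) :
    selDepthA2₁₃ θ hP K₀ g₀ os ρ n₁ K t ≤ n₁ :=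
  Nat.lt_succ_iff.1 (Finset.mem_range.1 (selDepthA2₁₃_spec θ hP K₀ g₀ os ρ n₁ K t).1)

/-- The selected b-depth is at most `n₂`. [bookkeeping] -/
theorem selDepthB2₁₃_le (θ : Stage13HParams F N) (hP : θ.Provisos₁₃CoPH F N) (K₀ : ℕ) (g₀ : ℕ → ℝ) (os : List (ULoop F)) (ρ' : ℕ → ℝ) (n₂ K : ℕ) (t : ℝ) :
    selDepthB2₁₃ θ hP K₀ g₀ os ρ' n₂ K t ≤ n₂ :=
  Nat.lt_succ_iff.1 (Finset.mem_range.1 (selDepthB2₁₃_spec θ hP K₀ g₀ os ρ' n₂ K t).1)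

/-- **RUN A's TWO-COLLAR SHELL MASS AT A DEPTH PAIR `(i, j)`.** [bookkeeping] -/
def gap2ShellSumA₁₃ (θ : Stage13HParams F N) (hP : θ.Provisos₁₃CoPH F N) (K₀ : ℕ) (g₀ : ℕ → ℝ) (os : List (ULoop F)) (ρ ρ' : ℕ → ℝ) (K i j : ℕ) (t : ℝ) : ℝ :=
  ∑ s : SeqOfRecord F θ.ν θ.τ9.M (histA₁₃ θ K₀ g₀ K) (K₀ + K) (K₀ + K),
    topGap2ShellAtLevel F N θ.toStage9Params (datumOfRecord₁₃CoPH F N θ hP) g₀ os (runA₁₃ F K₀ g₀ K) (histA₁₃ θ K₀ g₀ K)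
      (cutGrid θ.ν (histA₁₃ θ K₀ g₀ K) (K₀ + K) (ρ K) (i + 2)) (cutGrid θ.ν (histA₁₃ θ K₀ g₀ K) (K₀ + K) (ρ K) (i + 1))
      (cutGrid θ.ν (histA₁₃ θ K₀ g₀ K) (K₀ + K) (ρ K) i)
      (bCutGrid θ.ν θ.A₁ (histA₁₃ θ K₀ g₀ K) (K₀ + K - 1) (ρ' K) (j + 2)) (bCutGrid θ.ν θ.A₁ (histA₁₃ θ K₀ g₀ K) (K₀ + K - 1) (ρ' K) (j + 1))
      (bCutGrid θ.ν θ.A₁ (histA₁₃ θ K₀ g₀ K) (K₀ + K - 1) (ρ' K) j) t (K₀ + K) s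

/-- **RUN B's TWO-COLLAR SHELL MASS AT A DEPTH PAIR `(i, j)`.** [bookkeeping] -/
def gap2ShellSumB₁₃ (θ : Stage13HParams F N) (hP : θ.Provisos₁₃CoPH F N) (K₀ : ℕ) (g₀ : ℕ → ℝ) (os : List (ULoop F)) (ρ ρ' : ℕ → ℝ) (K i j : ℕ) (t : ℝ) : ℝ :=
  ∑ s' : SeqOfRecord F θ.ν θ.τ9.M (histB₁₃ θ K₀ g₀ K) (K₀ + K + 1) (K₀ + K + 1),
    topGap2ShellAtLevel F N θ.toStage9Params (datumOfRecord₁₃CoPH F N θ hP) g₀ os (runB₁₃ F K₀ g₀ K) (histB₁₃ θ K₀ g₀ K)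
      (cutGrid θ.ν (histB₁₃ θ K₀ g₀ K) (K₀ + K + 1) (ρ K) (i + 2)) (cutGrid θ.ν (histB₁₃ θ K₀ g₀ K) (K₀ + K + 1) (ρ K) (i + 1))
      (cutGrid θ.ν (histB₁₃ θ K₀ g₀ K) (K₀ + K + 1) (ρ K) i)
      (bCutGrid θ.ν θ.A₁ (histB₁₃ θ K₀ g₀ K) (K₀ + K) (ρ' K) (j + 2)) (bCutGrid θ.ν θ.A₁ (histB₁₃ θ K₀ g₀ K) (K₀ + K) (ρ' K) (j + 1))
      (bCutGrid θ.ν θ.A₁ (histB₁₃ θ K₀ g₀ K) (K₀ + K) (ρ' K) j) t (K₀ + K + 1) s'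

/-! ## §D3 The keyed carriers at the selected middle letters -/

/-- **RUN A's DOUBLY-GAPPED CLASS WEIGHT** at a key: the fibre sum along `keyA₁₃` of the pair-lettered terms at the selected middle letters
`(ε(1 − ρ_K)^{i⋆+1}, 2δ(1 − ρ′_K)^{j⋆+1})`. [bookkeeping] -/
def gapWeight2A₁₃ (θ : Stage13HParams F N) (hP : θ.Provisos₁₃CoPH F N) (K₀ : ℕ) (g₀ : ℕ → ℝ) (os : List (ULoop F)) (ρ ρ' : ℕ → ℝ) (n₁ n₂ : ℕ → ℕ)
    (K : ℕ) (t : ℝ) (x : Σ K, SiteSeqKey F (K₀ + K)) : ℝ :=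
  letI : ∀ Kc, DecidableEq (SiteSeqKey F Kc) := fun _ => Classical.decEq _
  ∑ s ∈ univ.filter (fun s => keyA₁₃ θ K₀ g₀ K s = x),
    topTerm2AtLevel F N θ.toStage9Params (datumOfRecord₁₃CoPH F N θ hP) g₀ os (runA₁₃ F K₀ g₀ K) (histA₁₃ θ K₀ g₀ K)
      (cutGrid θ.ν (histA₁₃ θ K₀ g₀ K) (K₀ + K) (ρ K) (selDepthA2₁₃ θ hP K₀ g₀ os ρ (n₁ K) K t + 1))
      (bCutGrid θ.ν θ.A₁ (histA₁₃ θ K₀ g₀ K) (K₀ + K - 1) (ρ' K) (selDepthB2₁₃ θ hP K₀ g₀ os ρ' (n₂ K) K t + 1)) t (K₀ + K) s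

/-- **RUN B's DOUBLY-GAPPED CLASS WEIGHT** at a key (top `K₀ + K + 1`, along `keyB₁₃`, the SAME depths). [bookkeeping] -/
def gapWeight2B₁₃ (θ : Stage13HParams F N) (hP : θ.Provisos₁₃CoPH F N) (K₀ : ℕ) (g₀ : ℕ → ℝ) (os : List (ULoop F)) (ρ ρ' : ℕ → ℝ) (n₁ n₂ : ℕ → ℕ)
    (K : ℕ) (t : ℝ) (x : Σ K, SiteSeqKey F (K₀ + K)) : ℝ :=
  letI : ∀ Kc, DecidableEq (SiteSeqKey F Kc) := fun _ => Classical.decEq _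
  ∑ s' ∈ univ.filter (fun s' => keyB₁₃ θ K₀ g₀ K s' = x),
    topTerm2AtLevel F N θ.toStage9Params (datumOfRecord₁₃CoPH F N θ hP) g₀ os (runB₁₃ F K₀ g₀ K) (histB₁₃ θ K₀ g₀ K)
      (cutGrid θ.ν (histB₁₃ θ K₀ g₀ K) (K₀ + K + 1) (ρ K) (selDepthA2₁₃ θ hP K₀ g₀ os ρ (n₁ K) K t + 1))
      (bCutGrid θ.ν θ.A₁ (histB₁₃ θ K₀ g₀ K) (K₀ + K) (ρ' K) (selDepthB2₁₃ θ hP K₀ g₀ os ρ' (n₂ K) K t + 1)) t (K₀ + K + 1) s'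

/-- **RUN A's TWO-COLLAR SHELL PART** at a key: the fibre sum of the two-collar shells at the selected depth pair. [bookkeeping] -/
def gapShell2A₁₃ (θ : Stage13HParams F N) (hP : θ.Provisos₁₃CoPH F N) (K₀ : ℕ) (g₀ : ℕ → ℝ) (os : List (ULoop F)) (ρ ρ' : ℕ → ℝ) (n₁ n₂ : ℕ → ℕ)
    (K : ℕ) (t : ℝ) (x : Σ K, SiteSeqKey F (K₀ + K)) : ℝ :=
  letI : ∀ Kc, DecidableEq (SiteSeqKey F Kc) := fun _ => Classical.decEq _
  ∑ s ∈ univ.filter (fun s => keyA₁₃ θ K₀ g₀ K s = x),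
    topGap2ShellAtLevel F N θ.toStage9Params (datumOfRecord₁₃CoPH F N θ hP) g₀ os (runA₁₃ F K₀ g₀ K) (histA₁₃ θ K₀ g₀ K)
      (cutGrid θ.ν (histA₁₃ θ K₀ g₀ K) (K₀ + K) (ρ K) (selDepthA2₁₃ θ hP K₀ g₀ os ρ (n₁ K) K t + 2))
      (cutGrid θ.ν (histA₁₃ θ K₀ g₀ K) (K₀ + K) (ρ K) (selDepthA2₁₃ θ hP K₀ g₀ os ρ (n₁ K) K t + 1))
      (cutGrid θ.ν (histA₁₃ θ K₀ g₀ K) (K₀ + K) (ρ K) (selDepthA2₁₃ θ hP K₀ g₀ os ρ (n₁ K) K t))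
      (bCutGrid θ.ν θ.A₁ (histA₁₃ θ K₀ g₀ K) (K₀ + K - 1) (ρ' K) (selDepthB2₁₃ θ hP K₀ g₀ os ρ' (n₂ K) K t + 2))
      (bCutGrid θ.ν θ.A₁ (histA₁₃ θ K₀ g₀ K) (K₀ + K - 1) (ρ' K) (selDepthB2₁₃ θ hP K₀ g₀ os ρ' (n₂ K) K t + 1))
      (bCutGrid θ.ν θ.A₁ (histA₁₃ θ K₀ g₀ K) (K₀ + K - 1) (ρ' K) (selDepthB2₁₃ θ hP K₀ g₀ os ρ' (n₂ K) K t)) t (K₀ + K) s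

/-- **RUN B's TWO-COLLAR SHELL PART** at a key. [bookkeeping] -/
def gapShell2B₁₃ (θ : Stage13HParams F N) (hP : θ.Provisos₁₃CoPH F N) (K₀ : ℕ) (g₀ : ℕ → ℝ) (os : List (ULoop F)) (ρ ρ' : ℕ → ℝ) (n₁ n₂ : ℕ → ℕ)
    (K : ℕ) (t : ℝ) (x : Σ K, SiteSeqKey F (K₀ + K)) : ℝ :=
  letI : ∀ Kc, DecidableEq (SiteSeqKey F Kc) := fun _ => Classical.decEq _
  ∑ s' ∈ univ.filter (fun s' => keyB₁₃ θ K₀ g₀ K s' = x),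
    topGap2ShellAtLevel F N θ.toStage9Params (datumOfRecord₁₃CoPH F N θ hP) g₀ os (runB₁₃ F K₀ g₀ K) (histB₁₃ θ K₀ g₀ K)
      (cutGrid θ.ν (histB₁₃ θ K₀ g₀ K) (K₀ + K + 1) (ρ K) (selDepthA2₁₃ θ hP K₀ g₀ os ρ (n₁ K) K t + 2))
      (cutGrid θ.ν (histB₁₃ θ K₀ g₀ K) (K₀ + K + 1) (ρ K) (selDepthA2₁₃ θ hP K₀ g₀ os ρ (n₁ K) K t + 1))
      (cutGrid θ.ν (histB₁₃ θ K₀ g₀ K) (K₀ + K + 1) (ρ K) (selDepthA2₁₃ θ hP K₀ g₀ os ρ (n₁ K) K t))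
      (bCutGrid θ.ν θ.A₁ (histB₁₃ θ K₀ g₀ K) (K₀ + K) (ρ' K) (selDepthB2₁₃ θ hP K₀ g₀ os ρ' (n₂ K) K t + 2))
      (bCutGrid θ.ν θ.A₁ (histB₁₃ θ K₀ g₀ K) (K₀ + K) (ρ' K) (selDepthB2₁₃ θ hP K₀ g₀ os ρ' (n₂ K) K t + 1))
      (bCutGrid θ.ν θ.A₁ (histB₁₃ θ K₀ g₀ K) (K₀ + K) (ρ' K) (selDepthB2₁₃ θ hP K₀ g₀ os ρ' (n₂ K) K t)) t (K₀ + K + 1) s'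

/-- **RUN A's DOUBLY-GAPPED CORE at a key** — equals `gapWeight2A₁₃ − gapShell2A₁₃` (below; the object N19′ matches on this road). [bookkeeping] -/
def gapCore2A₁₃ (θ : Stage13HParams F N) (hP : θ.Provisos₁₃CoPH F N) (K₀ : ℕ) (g₀ : ℕ → ℝ) (os : List (ULoop F)) (ρ ρ' : ℕ → ℝ) (n₁ n₂ : ℕ → ℕ)
    (K : ℕ) (t : ℝ) (x : Σ K, SiteSeqKey F (K₀ + K)) : ℝ :=
  letI : ∀ Kc, DecidableEq (SiteSeqKey F Kc) := fun _ => Classical.decEq _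
  ∑ s ∈ univ.filter (fun s => keyA₁₃ θ K₀ g₀ K s = x),
    topGap2CoreAtLevel F N θ.toStage9Params (datumOfRecord₁₃CoPH F N θ hP) g₀ os (runA₁₃ F K₀ g₀ K) (histA₁₃ θ K₀ g₀ K)
      (cutGrid θ.ν (histA₁₃ θ K₀ g₀ K) (K₀ + K) (ρ K) (selDepthA2₁₃ θ hP K₀ g₀ os ρ (n₁ K) K t + 2))
      (cutGrid θ.ν (histA₁₃ θ K₀ g₀ K) (K₀ + K) (ρ K) (selDepthA2₁₃ θ hP K₀ g₀ os ρ (n₁ K) K t))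
      (bCutGrid θ.ν θ.A₁ (histA₁₃ θ K₀ g₀ K) (K₀ + K - 1) (ρ' K) (selDepthB2₁₃ θ hP K₀ g₀ os ρ' (n₂ K) K t + 2))
      (bCutGrid θ.ν θ.A₁ (histA₁₃ θ K₀ g₀ K) (K₀ + K - 1) (ρ' K) (selDepthB2₁₃ θ hP K₀ g₀ os ρ' (n₂ K) K t)) t (K₀ + K) s

/-- **RUN B's DOUBLY-GAPPED CORE at a key.** [bookkeeping] -/
def gapCore2B₁₃ (θ : Stage13HParams F N) (hP : θ.Provisos₁₃CoPH F N) (K₀ : ℕ) (g₀ : ℕ → ℝ) (os : List (ULoop F)) (ρ ρ' : ℕ → ℝ) (n₁ n₂ : ℕ → ℕ)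
    (K : ℕ) (t : ℝ) (x : Σ K, SiteSeqKey F (K₀ + K)) : ℝ :=
  letI : ∀ Kc, DecidableEq (SiteSeqKey F Kc) := fun _ => Classical.decEq _
  ∑ s' ∈ univ.filter (fun s' => keyB₁₃ θ K₀ g₀ K s' = x),
    topGap2CoreAtLevel F N θ.toStage9Params (datumOfRecord₁₃CoPH F N θ hP) g₀ os (runB₁₃ F K₀ g₀ K) (histB₁₃ θ K₀ g₀ K)
      (cutGrid θ.ν (histB₁₃ θ K₀ g₀ K) (K₀ + K + 1) (ρ K) (selDepthA2₁₃ θ hP K₀ g₀ os ρ (n₁ K) K t + 2))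
      (cutGrid θ.ν (histB₁₃ θ K₀ g₀ K) (K₀ + K + 1) (ρ K) (selDepthA2₁₃ θ hP K₀ g₀ os ρ (n₁ K) K t))
      (bCutGrid θ.ν θ.A₁ (histB₁₃ θ K₀ g₀ K) (K₀ + K) (ρ' K) (selDepthB2₁₃ θ hP K₀ g₀ os ρ' (n₂ K) K t + 2))
      (bCutGrid θ.ν θ.A₁ (histB₁₃ θ K₀ g₀ K) (K₀ + K) (ρ' K) (selDepthB2₁₃ θ hP K₀ g₀ os ρ' (n₂ K) K t)) t (K₀ + K + 1) s'

/-- ★★ **RUN A: DOUBLY-GAPPED CLASS WEIGHT − TWO-COLLAR SHELL PART = DOUBLY-GAPPED CORE**, key by key, identically (no rows). [bookkeeping] -/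
theorem gapWeight2A₁₃_sub_gapShell2A₁₃ (θ : Stage13HParams F N) (hP : θ.Provisos₁₃CoPH F N) (K₀ : ℕ) (g₀ : ℕ → ℝ) (os : List (ULoop F)) (ρ ρ' : ℕ → ℝ)
    (n₁ n₂ : ℕ → ℕ) (K : ℕ) (t : ℝ) (x : Σ K, SiteSeqKey F (K₀ + K)) :
    gapWeight2A₁₃ θ hP K₀ g₀ os ρ ρ' n₁ n₂ K t x - gapShell2A₁₃ θ hP K₀ g₀ os ρ ρ' n₁ n₂ K t x = gapCore2A₁₃ θ hP K₀ g₀ os ρ ρ' n₁ n₂ K t x := by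
  letI : ∀ Kc, DecidableEq (SiteSeqKey F Kc) := fun _ => Classical.decEq _
  unfold gapWeight2A₁₃ gapShell2A₁₃ gapCore2A₁₃
  rw [← Finset.sum_sub_distrib]
  exact Finset.sum_congr rfl fun s _ =>
    topTerm2AtLevel_sub_topGap2ShellAtLevel F N θ.toStage9Params (datumOfRecord₁₃CoPH F N θ hP) g₀ os (runA₁₃ F K₀ g₀ K) (histA₁₃ θ K₀ g₀ K) _ _ _ _ _ _ t (K₀ + K) s

/-- ★★ **RUN B: the same.** [bookkeeping] -/
theorem gapWeight2B₁₃_sub_gapShell2B₁₃ (θ : Stage13HParams F N) (hP : θ.Provisos₁₃CoPH F N) (K₀ : ℕ) (g₀ : ℕ → ℝ) (os : List (ULoop F)) (ρ ρ' : ℕ → ℝ)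
    (n₁ n₂ : ℕ → ℕ) (K : ℕ) (t : ℝ) (x : Σ K, SiteSeqKey F (K₀ + K)) :
    gapWeight2B₁₃ θ hP K₀ g₀ os ρ ρ' n₁ n₂ K t x - gapShell2B₁₃ θ hP K₀ g₀ os ρ ρ' n₁ n₂ K t x = gapCore2B₁₃ θ hP K₀ g₀ os ρ ρ' n₁ n₂ K t x := by
  letI : ∀ Kc, DecidableEq (SiteSeqKey F Kc) := fun _ => Classical.decEq _
  unfold gapWeight2B₁₃ gapShell2B₁₃ gapCore2B₁₃
  rw [← Finset.sum_sub_distrib]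
  exact Finset.sum_congr rfl fun s' _ =>
    topTerm2AtLevel_sub_topGap2ShellAtLevel F N θ.toStage9Params (datumOfRecord₁₃CoPH F N θ hP) g₀ os (runB₁₃ F K₀ g₀ K) (histB₁₃ θ K₀ g₀ K) _ _ _ _ _ _ t (K₀ + K + 1) s'

/-! ## §D4 The doubly-gapped spine reading -/

variable (N) in
/-- ★★ **THE DOUBLY-GAPPED SPINE READING AT OFFSET `K₀`** (persistence policy `jcut`, width letters `ρ, ρ′`, depth letters `n₁, n₂`): the lane owner's `crGap₁₃VAt` field for field —
index type, class set, bad class, `l₀ := 1`, `vol := F.side ^ 4`, canonical `W ∕ Wsh ∕ δ` — with the DOUBLY-GAPPED carriers `gapWeight2A∕B₁₃ ∕ gapShell2A∕B₁₃`. [bookkeeping] -/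
def crGap2₁₃VAt (K₀ : ℕ) (jcut : ℕ → ℕ) (ρ ρ' : WidthLetter₁₃CoPH N) (n₁ n₂ : DepthLetter₁₃CoPH N) : SpineReading₁₃CoPH N := fun F θ hP g₀ os =>
  { ι := Σ K, SiteSeqKey F (K₀ + K)
    dec := Classical.decEq _
    l₀ := 1
    vol := F.side ^ 4
    K₀ := K₀
    T := classSet₁₃ θ K₀ g₀
    A := gapWeight2A₁₃ θ hP K₀ g₀ os (ρ F θ hP g₀ os) (ρ' F θ hP g₀ os) (n₁ F θ hP g₀ os) (n₂ F θ hP g₀ os)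
    B := gapWeight2B₁₃ θ hP K₀ g₀ os (ρ F θ hP g₀ os) (ρ' F θ hP g₀ os) (n₁ F θ hP g₀ os) (n₂ F θ hP g₀ os)
    shA := gapShell2A₁₃ θ hP K₀ g₀ os (ρ F θ hP g₀ os) (ρ' F θ hP g₀ os) (n₁ F θ hP g₀ os) (n₂ F θ hP g₀ os)
    shB := gapShell2B₁₃ θ hP K₀ g₀ os (ρ F θ hP g₀ os) (ρ' F θ hP g₀ os) (n₁ F θ hP g₀ os) (n₂ F θ hP g₀ os)
    Bad := badClass₁₃ θ K₀ g₀ jcut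
    W := wInf 1 (classSet₁₃ θ K₀ g₀) (gapWeight2A₁₃ θ hP K₀ g₀ os (ρ F θ hP g₀ os) (ρ' F θ hP g₀ os) (n₁ F θ hP g₀ os) (n₂ F θ hP g₀ os))
      (gapWeight2B₁₃ θ hP K₀ g₀ os (ρ F θ hP g₀ os) (ρ' F θ hP g₀ os) (n₁ F θ hP g₀ os) (n₂ F θ hP g₀ os)) (badClass₁₃ θ K₀ g₀ jcut)
    Wsh := wshInf 1 (classSet₁₃ θ K₀ g₀) (gapWeight2A₁₃ θ hP K₀ g₀ os (ρ F θ hP g₀ os) (ρ' F θ hP g₀ os) (n₁ F θ hP g₀ os) (n₂ F θ hP g₀ os))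
      (gapWeight2B₁₃ θ hP K₀ g₀ os (ρ F θ hP g₀ os) (ρ' F θ hP g₀ os) (n₁ F θ hP g₀ os) (n₂ F θ hP g₀ os))
      (gapShell2A₁₃ θ hP K₀ g₀ os (ρ F θ hP g₀ os) (ρ' F θ hP g₀ os) (n₁ F θ hP g₀ os) (n₂ F θ hP g₀ os))
      (gapShell2B₁₃ θ hP K₀ g₀ os (ρ F θ hP g₀ os) (ρ' F θ hP g₀ os) (n₁ F θ hP g₀ os) (n₂ F θ hP g₀ os))
    δ := letI : DecidableEq (Σ K, SiteSeqKey F (K₀ + K)) := Classical.decEq _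
      deltaCan 1 (F.side ^ 4) (classSet₁₃ θ K₀ g₀) (badClass₁₃ θ K₀ g₀ jcut)
        (fun K t x => gapWeight2A₁₃ θ hP K₀ g₀ os (ρ F θ hP g₀ os) (ρ' F θ hP g₀ os) (n₁ F θ hP g₀ os) (n₂ F θ hP g₀ os) K t x -
          gapShell2A₁₃ θ hP K₀ g₀ os (ρ F θ hP g₀ os) (ρ' F θ hP g₀ os) (n₁ F θ hP g₀ os) (n₂ F θ hP g₀ os) K t x)
        (fun K t x => gapWeight2B₁₃ θ hP K₀ g₀ os (ρ F θ hP g₀ os) (ρ' F θ hP g₀ os) (n₁ F θ hP g₀ os) (n₂ F θ hP g₀ os) K t x -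
          gapShell2B₁₃ θ hP K₀ g₀ os (ρ F θ hP g₀ os) (ρ' F θ hP g₀ os) (n₁ F θ hP g₀ os) (n₂ F θ hP g₀ os) K t x) }

variable (N) in
/-- ★★ **THE DOUBLY-GAPPED SPINE READING** `crGap2₁₃V := crGap2₁₃VAt 0`. [bookkeeping] -/
def crGap2₁₃V (jcut : ℕ → ℕ) (ρ ρ' : WidthLetter₁₃CoPH N) (n₁ n₂ : DepthLetter₁₃CoPH N) : SpineReading₁₃CoPH N :=
  crGap2₁₃VAt N 0 jcut ρ ρ' n₁ n₂

/-! ### The dictionary (all `rfl`) -/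

section Dictionary2

variable (K₀ : ℕ) (jcut : ℕ → ℕ) (ρ ρ' : WidthLetter₁₃CoPH N) (n₁ n₂ : DepthLetter₁₃CoPH N) (θ : Stage13HParams F N) (hP : θ.Provisos₁₃CoPH F N) (g₀ : ℕ → ℝ)
  (os : List (ULoop F))

/-- `ι`. [bookkeeping] -/
theorem crGap2₁₃VAt_ι : (crGap2₁₃VAt N K₀ jcut ρ ρ' n₁ n₂ F θ hP g₀ os).ι = (Σ K, SiteSeqKey F (K₀ + K)) := rfl
/-- `l₀ = 1`. [bookkeeping] -/
@[simp] theorem crGap2₁₃VAt_l₀ : (crGap2₁₃VAt N K₀ jcut ρ ρ' n₁ n₂ F θ hP g₀ os).l₀ = 1 := rfl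
/-- `vol = F.side ^ 4`. [bookkeeping] -/
theorem crGap2₁₃VAt_vol : (crGap2₁₃VAt N K₀ jcut ρ ρ' n₁ n₂ F θ hP g₀ os).vol = F.side ^ 4 := rfl
/-- `K₀`. [bookkeeping] -/
@[simp] theorem crGap2₁₃VAt_K₀ : (crGap2₁₃VAt N K₀ jcut ρ ρ' n₁ n₂ F θ hP g₀ os).K₀ = K₀ := rfl
/-- `T` = n20-d's keyed class set of record. [bookkeeping] -/
theorem crGap2₁₃VAt_T : (crGap2₁₃VAt N K₀ jcut ρ ρ' n₁ n₂ F θ hP g₀ os).T = classSet₁₃ θ K₀ g₀ := rfl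
/-- `A` = run A's doubly-gapped fibre sums. [bookkeeping] -/
theorem crGap2₁₃VAt_A : (crGap2₁₃VAt N K₀ jcut ρ ρ' n₁ n₂ F θ hP g₀ os).A =
    gapWeight2A₁₃ θ hP K₀ g₀ os (ρ F θ hP g₀ os) (ρ' F θ hP g₀ os) (n₁ F θ hP g₀ os) (n₂ F θ hP g₀ os) := rfl
/-- `B` = run B's doubly-gapped fibre sums. [bookkeeping] -/
theorem crGap2₁₃VAt_B : (crGap2₁₃VAt N K₀ jcut ρ ρ' n₁ n₂ F θ hP g₀ os).B =
    gapWeight2B₁₃ θ hP K₀ g₀ os (ρ F θ hP g₀ os) (ρ' F θ hP g₀ os) (n₁ F θ hP g₀ os) (n₂ F θ hP g₀ os) := rfl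
/-- `shA` = run A's two-collar shell part. [bookkeeping] -/
theorem crGap2₁₃VAt_shA : (crGap2₁₃VAt N K₀ jcut ρ ρ' n₁ n₂ F θ hP g₀ os).shA =
    gapShell2A₁₃ θ hP K₀ g₀ os (ρ F θ hP g₀ os) (ρ' F θ hP g₀ os) (n₁ F θ hP g₀ os) (n₂ F θ hP g₀ os) := rfl
/-- `shB` = run B's two-collar shell part. [bookkeeping] -/
theorem crGap2₁₃VAt_shB : (crGap2₁₃VAt N K₀ jcut ρ ρ' n₁ n₂ F θ hP g₀ os).shB =
    gapShell2B₁₃ θ hP K₀ g₀ os (ρ F θ hP g₀ os) (ρ' F θ hP g₀ os) (n₁ F θ hP g₀ os) (n₂ F θ hP g₀ os) := rfl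
/-- `Bad` = n20-d's persistence class of record. [bookkeeping] -/
theorem crGap2₁₃VAt_Bad : (crGap2₁₃VAt N K₀ jcut ρ ρ' n₁ n₂ F θ hP g₀ os).Bad = badClass₁₃ θ K₀ g₀ jcut := rfl
/-- The record object reads the offset-`0` form (`rfl`). [bookkeeping] -/
theorem crGap2₁₃V_eq : crGap2₁₃V N jcut ρ ρ' n₁ n₂ = crGap2₁₃VAt N 0 jcut ρ ρ' n₁ n₂ := rfl
/-- SAME index type, class set, bad class and volume AS the lane owner's `crGap₁₃VAt` (and as n20-d's `crOfRecord₁₃VAt`) — the readings differ only in their carriers.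
[bookkeeping] -/
theorem crGap2₁₃VAt_T_eq_crGap₁₃VAt_T (ρ₁ : WidthLetter₁₃CoPH N) (n' : DepthLetter₁₃CoPH N) :
    (crGap2₁₃VAt N K₀ jcut ρ ρ' n₁ n₂ F θ hP g₀ os).T = (crGap₁₃VAt N K₀ jcut ρ₁ n' F θ hP g₀ os).T ∧
      (crGap2₁₃VAt N K₀ jcut ρ ρ' n₁ n₂ F θ hP g₀ os).Bad = (crGap₁₃VAt N K₀ jcut ρ₁ n' F θ hP g₀ os).Bad ∧
      (crGap2₁₃VAt N K₀ jcut ρ ρ' n₁ n₂ F θ hP g₀ os).vol = (crGap₁₃VAt N K₀ jcut ρ₁ n' F θ hP g₀ os).vol := ⟨rfl, rfl, rfl⟩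

end Dictionary2

end Reading2

end Summit.QuantumFields.YangMills.Theorems.N21GappedTopPair13CoPH

end
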